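/-
Origin: expansion seat `planner-pub-hodgecm-pv13-g5-0`, handover #1 2026-08-18T12:5xZ (md5 348e5d22fcabf80adb18d0fcb4555443; NEW additive leaf; ONE import rewrite Pv09g6.RestrictedTensor -> HodgeCM.PerL34.RestrictedTensor (pv09-g6 #1, RUN 29 row 9ca5fcf0); land AFTER HodgeCM/PerL34/RestrictedTensor.lean and BEFORE pv09-g7 #1 RestrictedTensorFunctor + my #2) (`HOME/pub-hodgecm-pv13-g5/lean/Pv13g5/RestrictedTensorL2.lean`, md5 348e5d22, 732 lines);
landed by the gen-8 packager in gate run 30 as `HodgeCM/PerL34/RestrictedTensorL2.lean` (import ^import Pv09g6\.RestrictedTensor[ \t]*$→import HodgeCM.PerL34.RestrictedTensor ×1).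
-/
/-
Copyright: HodgeCM publication cell (pub-hodgecm), seam S3 (𝓕-side / genuine idelic torus end).  Prover seat
pub-hodgecm-pv13-g5 (DAG-node prover #13, generation 5), file #1; intended final place
`HodgeCM/PerL34/RestrictedTensorL2.lean`.  WIP import: `Pv09g6.RestrictedTensor` ↦ `HodgeCM.PerL34.RestrictedTensor`
(pv09-g6 HANDOVER #1, RUN 29).  Complete proofs, no new axioms, nothing cited.  Released under the package licence.
-/
import Summits.HodgeConjecture.HodgeCM.PerL34.RestrictedTensor_2
import Mathlib.Analysis.Normed.Operator.Extend
import Mathlib.Analysis.Normed.Module.Completion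
import Mathlib.MeasureTheory.Constructions.Pi
import Mathlib.MeasureTheory.Integral.Pi
import Mathlib.MeasureTheory.Function.L2Space
import Mathlib.MeasureTheory.Function.LpSpace.Indicator
import Mathlib.MeasureTheory.Measure.Haar.Basic
import Mathlib.Topology.Algebra.RestrictedProduct.TopologicalSpace

/-!
# `L²` of a restricted product IS the restricted tensor product of the local `L²` spaces

Pure functional analysis / measure theory (Mathlib + this package's `RestrictedTensor` only): NO statement of
PerL / QW8 / the 2001 programme is cited or used.

## §1  The universal property of `⊗′_i (H_i, e_i)` (`RestrictedTensor.lift`)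

For a unit family `𝓔` and ANY complex Hilbert space `F`, a map `Φ : RVec 𝓔 → F` realising the product kernel,
`⟪Φ x, Φ y⟫ = ∏ᶠ_i ⟪x_i, y_i⟫`, extends UNIQUELY to a linear isometry `lift : ⊗′_i (H_i, e_i) →ₗᵢ[ℂ] F` with
`lift (⊗ x) = Φ x` (GNS: the pure tensors are total and their Gram kernel is the product kernel).

## §2  The product measure on a restricted product and the product functions

For a restricted product `X = Πʳ_i [R_i, C_i]` of locally compact second countable abelian groups `R_i` along
compact open subgroups `C_i`, an additive Haar measure `μ` on `X` with `μ(∏_i C_i) = 1` and additive Haar measures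
`m_i` on `R_i` with `m_i(C_i) = 1`:

* `measurePreserving_evalT` — for every finite set `T` of indices the coordinate map `x ↦ (x_i)_{i ∈ T}` is
  MEASURE PRESERVING from `(cyl_T, μ)`, `cyl_T = {x | x_j ∈ C_j ∀ j ∉ T}`, to `(∏_{i∈T} R_i, ⊗_{i∈T} m_i)`
  (both are Haar measures on `∏_{i ∈ T} R_i` giving `∏ C_i` mass one);
* `prodLp T f ∈ L²(X, μ)` — the product function `1_{cyl_T}(x) · ∏_{i ∈ T} f_i(x_i)` of `f_i ∈ L²(R_i, m_i)`,
  with `⟪prodLp T f, prodLp T g⟫ = ∏_{i ∈ T} ⟪f_i, g_i⟫` (Fubini on the finite product) and independence of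
  `T` as long as the added factors are `1_{C_i}`.

## §3  The dictionary `⊗_i f_i ↦ (x ↦ ∏_i f_i(x_i))`

With `H_i = L²(R_i, m_i)`, `e_i = 1_{C_i}`: the pure-tensor map realises the product kernel, whence (§1) THE
isometric embedding `tensorToL2 : ⊗′_i (L²(R_i), 1_{C_i}) →ₗᵢ[ℂ] L²(Πʳ_i [R_i, C_i], μ)` with
`tensorToL2 (⊗ f) = prodLp T f` for every finite `T` outside which `f_i = 1_{C_i}`, in particular
`tensorToL2 (⊗_i 1_{C_i}) = 1_{∏ C_i}`.  (Kernel meaning of "`φ = ⊗_v φ_v` is a pure tensor in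
`L²(𝔸³) = ⊗′_v L²(F_v³)`", PerL v5 l. 600, for the additive restricted products of this package.)
-/

set_option autoImplicit false

noncomputable section

open MeasureTheory MeasureTheory.Measure Set Filter Function Complex ComplexConjugate Topology
open scoped RestrictedProduct InnerProductSpace NNReal ENNReal

namespace HodgeCM.PerL34.RestrictedTensor

universe u v

/-! ## §1  The universal property of the restricted tensor product -/

section Lift

variable {ι : Type u} {H : ι → Type v} [∀ i, NormedAddCommGroup (H i)] [∀ i, InnerProductSpace ℂ (H i)]
  {𝓔 : UnitFamily H}
  {F : Type*} [NormedAddCommGroup F] [InnerProductSpace ℂ F]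

/-- the linear map on formal combinations induced by `Φ : RVec 𝓔 → F`. -/
def liftPre (Φ : RVec 𝓔 → F) : Pre 𝓔 →ₗ[ℂ] F := Finsupp.linearCombination ℂ Φ

/-- (Ported verbatim from the HodgeCMPerL package; no docstring in the source.) -/
theorem liftPre_apply (Φ : RVec 𝓔 → F) (f : Pre 𝓔) : liftPre Φ f = f.sum fun x a => a • Φ x :=
  Finsupp.linearCombination_apply ℂ f

/-- (Ported verbatim from the HodgeCMPerL package; no docstring in the source.) -/
@[simp] theorem liftPre_single (Φ : RVec 𝓔 → F) (x : RVec 𝓔) (a : ℂ) :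
    liftPre Φ (Finsupp.single x a) = a • Φ x := by
  rw [liftPre, Finsupp.linearCombination_single]

/-- a kernel map preserves inner products of formal combinations. -/
theorem inner_liftPre (Φ : RVec 𝓔 → F) (hΦ : ∀ x y, ⟪Φ x, Φ y⟫_ℂ = kfun x y) (f g : Pre 𝓔) :
    ⟪liftPre Φ f, liftPre Φ g⟫_ℂ = ⟪f, g⟫_ℂ := by
  rw [liftPre_apply, liftPre_apply, inner_pre_def]
  simp only [Finsupp.sum]
  rw [sum_inner]
  refine Finset.sum_congr rfl fun x _ => ?_
  rw [inner_sum]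
  refine Finset.sum_congr rfl fun y _ => ?_
  rw [inner_smul_left, inner_smul_right, hΦ]; ring

/-- (Ported verbatim from the HodgeCMPerL package; no docstring in the source.) -/
theorem norm_liftPre (Φ : RVec 𝓔 → F) (hΦ : ∀ x y, ⟪Φ x, Φ y⟫_ℂ = kfun x y) (f : Pre 𝓔) :
    ‖liftPre Φ f‖ = ‖f‖ := by
  rw [norm_eq_sqrt_re_inner (𝕜 := ℂ), norm_eq_sqrt_re_inner (𝕜 := ℂ) f, inner_liftPre Φ hΦ]

/-- the induced map on formal combinations as a linear isometry (for the GNS seminorm). -/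
def liftPreₗᵢ (Φ : RVec 𝓔 → F) (hΦ : ∀ x y, ⟪Φ x, Φ y⟫_ℂ = kfun x y) : Pre 𝓔 →ₗᵢ[ℂ] F :=
  { liftPre Φ with norm_map' := norm_liftPre Φ hΦ }

/-- (Ported verbatim from the HodgeCMPerL package; no docstring in the source.) -/
@[simp] theorem liftPreₗᵢ_apply (Φ : RVec 𝓔 → F) (hΦ : ∀ x y, ⟪Φ x, Φ y⟫_ℂ = kfun x y) (f : Pre 𝓔) :
    liftPreₗᵢ Φ hΦ f = liftPre Φ f := rfl

variable [CompleteSpace F]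

/-- the extension to the completion, as a continuous linear map -/
def liftL (Φ : RVec 𝓔 → F) (hΦ : ∀ x y, ⟪Φ x, Φ y⟫_ℂ = kfun x y) : Space 𝓔 →L[ℂ] F :=
  (liftPreₗᵢ Φ hΦ).toContinuousLinearMap.extend (UniformSpace.Completion.toComplL : Pre 𝓔 →L[ℂ] Space 𝓔)

/-- (Ported verbatim from the HodgeCMPerL package; no docstring in the source.) -/
theorem denseRange_toComplL :
    DenseRange (UniformSpace.Completion.toComplL : Pre 𝓔 →L[ℂ] Space 𝓔) := by
  rw [UniformSpace.Completion.coe_toComplL]; exact UniformSpace.Completion.denseRange_coe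

/-- (Ported verbatim from the HodgeCMPerL package; no docstring in the source.) -/
theorem isUniformInducing_toComplL :
    IsUniformInducing (UniformSpace.Completion.toComplL : Pre 𝓔 →L[ℂ] Space 𝓔) := by
  rw [UniformSpace.Completion.coe_toComplL]; exact UniformSpace.Completion.isUniformInducing_coe _

/-- (Ported verbatim from the HodgeCMPerL package; no docstring in the source.) -/
theorem liftL_coe (Φ : RVec 𝓔 → F) (hΦ : ∀ x y, ⟪Φ x, Φ y⟫_ℂ = kfun x y) (f : Pre 𝓔) :
    liftL Φ hΦ (f : Space 𝓔) = liftPre Φ f := by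
  have h := ContinuousLinearMap.extend_eq (liftPreₗᵢ Φ hΦ).toContinuousLinearMap denseRange_toComplL
    isUniformInducing_toComplL f
  rw [UniformSpace.Completion.coe_toComplL] at h
  exact h

/-- (Ported verbatim from the HodgeCMPerL package; no docstring in the source.) -/
theorem norm_liftL (Φ : RVec 𝓔 → F) (hΦ : ∀ x y, ⟪Φ x, Φ y⟫_ℂ = kfun x y) (z : Space 𝓔) :
    ‖liftL Φ hΦ z‖ = ‖z‖ := by
  refine UniformSpace.Completion.induction_on z
    (isClosed_eq (liftL Φ hΦ).continuous.norm continuous_norm) fun f => ?_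
  rw [liftL_coe, UniformSpace.Completion.norm_coe, norm_liftPre Φ hΦ]

/-- **The universal property of `⊗′_i (H_i, e_i)`**: a realisation `Φ` of the product kernel in a Hilbert space
`F` (`⟪Φ x, Φ y⟫ = ∏ᶠ_i ⟪x_i, y_i⟫`) extends to a linear isometry `⊗′ H →ₗᵢ[ℂ] F`, `⊗ x ↦ Φ x`. -/
def lift (Φ : RVec 𝓔 → F) (hΦ : ∀ x y, ⟪Φ x, Φ y⟫_ℂ = kfun x y) : Space 𝓔 →ₗᵢ[ℂ] F :=
  { (liftL Φ hΦ).toLinearMap with norm_map' := norm_liftL Φ hΦ }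

/-- (Ported verbatim from the HodgeCMPerL package; no docstring in the source.) -/
theorem lift_apply (Φ : RVec 𝓔 → F) (hΦ : ∀ x y, ⟪Φ x, Φ y⟫_ℂ = kfun x y) (z : Space 𝓔) :
    lift Φ hΦ z = liftL Φ hΦ z := rfl

/-- (Ported verbatim from the HodgeCMPerL package; no docstring in the source.) -/
theorem lift_coe (Φ : RVec 𝓔 → F) (hΦ : ∀ x y, ⟪Φ x, Φ y⟫_ℂ = kfun x y) (f : Pre 𝓔) :
    lift Φ hΦ (f : Space 𝓔) = f.sum fun x a => a • Φ x := by
  rw [lift_apply, liftL_coe, liftPre_apply]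

/-- `lift Φ (⊗ x) = Φ x` -/
@[simp] theorem lift_tp (Φ : RVec 𝓔 → F) (hΦ : ∀ x y, ⟪Φ x, Φ y⟫_ℂ = kfun x y) (x : RVec 𝓔) :
    lift Φ hΦ (tp 𝓔 x) = Φ x := by
  rw [tp, lift_apply, liftL_coe, liftPre_single, one_smul]

/-- uniqueness: a continuous linear map agreeing with `Φ` on pure tensors is `lift Φ`. -/
theorem eq_lift (Φ : RVec 𝓔 → F) (hΦ : ∀ x y, ⟪Φ x, Φ y⟫_ℂ = kfun x y) (A : Space 𝓔 →L[ℂ] F)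
    (hA : ∀ x, A (tp 𝓔 x) = Φ x) : A = (lift Φ hΦ).toContinuousLinearMap :=
  clm_ext (𝓔 := 𝓔) fun x => by rw [hA, LinearIsometry.coe_toContinuousLinearMap, lift_tp]

/-- the range of `lift Φ` is the closure of the span of the `Φ x`. -/
theorem range_lift (Φ : RVec 𝓔 → F) (hΦ : ∀ x y, ⟪Φ x, Φ y⟫_ℂ = kfun x y) :
    (LinearMap.range (lift Φ hΦ).toLinearMap : Set F) = closure (Submodule.span ℂ (Set.range Φ) : Set F) := by
  apply le_antisymm
  · rintro _ ⟨z, rfl⟩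
    have hz : z ∈ closure ((Submodule.span ℂ (Set.range (tp 𝓔)) : Submodule ℂ (Space 𝓔)) : Set (Space 𝓔)) :=
      (dense_span_tp (𝓔 := 𝓔)).closure_eq.symm ▸ Set.mem_univ z
    have hle : (Submodule.span ℂ (Set.range (tp 𝓔))).map (lift Φ hΦ).toLinearMap ≤ Submodule.span ℂ (Set.range Φ) :=
      (Submodule.map_span_le _ _ _).2 (by
        rintro _ ⟨x, rfl⟩
        exact Submodule.subset_span ⟨x, (lift_tp Φ hΦ x).symm⟩)
    have himage : (lift Φ hΦ) '' ((Submodule.span ℂ (Set.range (tp 𝓔)) : Submodule ℂ (Space 𝓔)) : Set (Space 𝓔))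
        ⊆ (Submodule.span ℂ (Set.range Φ) : Set F) := by
      rintro _ ⟨w, hw, rfl⟩
      exact hle (Submodule.mem_map_of_mem hw)
    exact closure_mono himage (mem_closure_image (lift Φ hΦ).continuous.continuousAt hz)
  · refine (closure_minimal ?_ ?_)
    · refine Submodule.span_le.2 ?_
      rintro _ ⟨x, rfl⟩
      exact ⟨tp 𝓔 x, lift_tp Φ hΦ x⟩
    · exact (lift Φ hΦ).isometry.isClosedEmbedding.isClosed_range

end Lift

/-! ## §2  The product measure on a restricted product `Πʳ_i [R_i, C_i]` -/

namespace ProdL2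

universe w

/-! ### §2.1 Boxes, cylinders, finite-coordinate maps -/
section Basic

variable {ι : Type u} {R : ι → Type v} {S : ι → Type w} [∀ i, SetLike (S i) (R i)] {C : ∀ i, S i}

variable (C) in
/-- the box `∏_i C_i ⊂ Πʳ_i [R_i, C_i]` -/
def boxSet : Set (Πʳ i, [R i, C i]) := {x | ∀ i, x.1 i ∈ (C i : Set (R i))}

/-- (Ported verbatim from the HodgeCMPerL package; no docstring in the source.) -/
theorem mem_boxSet_iff (x : Πʳ i, [R i, C i]) : x ∈ boxSet C ↔ ∀ i, x i ∈ (C i : Set (R i)) := Iff.rfl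

variable (C) in
/-- the cylinder over the finite set `T` of coordinates: `∏_{i ∈ T} R_i × ∏_{i ∉ T} C_i` -/
def cylSet (T : Finset ι) : Set (Πʳ i, [R i, C i]) := {x | ∀ i, i ∉ T → x.1 i ∈ (C i : Set (R i))}

/-- (Ported verbatim from the HodgeCMPerL package; no docstring in the source.) -/
theorem mem_cylSet_iff (T : Finset ι) (x : Πʳ i, [R i, C i]) :
    x ∈ cylSet C T ↔ ∀ i, i ∉ T → x i ∈ (C i : Set (R i)) := Iff.rfl

/-- (Ported verbatim from the HodgeCMPerL package; no docstring in the source.) -/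
theorem cylSet_mono {T T' : Finset ι} (h : T ⊆ T') : cylSet C T ⊆ cylSet C T' :=
  fun _ hx i hi => hx i fun hiT => hi (h hiT)

/-- (Ported verbatim from the HodgeCMPerL package; no docstring in the source.) -/
theorem boxSet_subset_cylSet (T : Finset ι) : boxSet C ⊆ cylSet C T := fun _ hx i _ => hx i

/-- (Ported verbatim from the HodgeCMPerL package; no docstring in the source.) -/
theorem cylSet_empty : cylSet C ∅ = boxSet C :=
  Set.ext fun _ => ⟨fun h i => h i (Finset.notMem_empty i), fun h i _ => h i⟩

variable (C) in
/-- evaluation at the coordinates in `T` -/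
def evalT (T : Finset ι) (x : Πʳ i, [R i, C i]) : ∀ i : T, R i.1 := fun i => x i.1

/-- (Ported verbatim from the HodgeCMPerL package; no docstring in the source.) -/
@[simp] theorem evalT_apply (T : Finset ι) (x : Πʳ i, [R i, C i]) (i : T) : evalT C T x i = x i.1 := rfl

section Alg

variable [∀ i, AddCommGroup (R i)] [∀ i, AddSubgroupClass (S i) (R i)]

open scoped Classical in
variable (C) in
/-- the embedding of the coordinates in `T` (zero elsewhere; auxiliary, used only to translate cylinders) -/
def embT (T : Finset ι) (a : ∀ i : T, R i.1) : Πʳ i, [R i, C i] :=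
  ⟨fun j => if h : j ∈ T then a ⟨j, h⟩ else 0, by
    filter_upwards [T.eventually_cofinite_notMem] with j hj
    rw [dif_neg hj]
    exact zero_mem (C j)⟩

/-- (Ported verbatim from the HodgeCMPerL package; no docstring in the source.) -/
theorem embT_apply_of_mem (T : Finset ι) (a : ∀ i : T, R i.1) {j : ι} (hj : j ∈ T) :
    embT C T a j = a ⟨j, hj⟩ := by
  simp [embT, RestrictedProduct.mk_apply, hj]

/-- (Ported verbatim from the HodgeCMPerL package; no docstring in the source.) -/
theorem embT_apply_of_not_mem (T : Finset ι) (a : ∀ i : T, R i.1) {j : ι} (hj : j ∉ T) :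
    embT C T a j = 0 := by
  simp [embT, RestrictedProduct.mk_apply, hj]

/-- (Ported verbatim from the HodgeCMPerL package; no docstring in the source.) -/
theorem evalT_embT_add (T : Finset ι) (a : ∀ i : T, R i.1) (x : Πʳ i, [R i, C i]) :
    evalT C T (embT C T a + x) = a + evalT C T x := by
  funext i
  rw [evalT_apply, RestrictedProduct.add_apply, embT_apply_of_mem T a i.2, Pi.add_apply, evalT_apply]

/-- (Ported verbatim from the HodgeCMPerL package; no docstring in the source.) -/
theorem preimage_add_embT_cylSet (T : Finset ι) (a : ∀ i : T, R i.1) :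
    (fun x => embT C T a + x) ⁻¹' cylSet C T = cylSet C T := by
  ext x
  simp only [mem_preimage, mem_cylSet_iff, RestrictedProduct.add_apply]
  refine forall₂_congr fun j hj => ?_
  rw [embT_apply_of_not_mem T a hj, zero_add]

end Alg

end Basic

/-! ### §2.2 Topology: open cylinders, compact boxes -/
section Top

variable {ι : Type u} {R : ι → Type v} [∀ i, TopologicalSpace (R i)]
  {S : ι → Type w} [∀ i, SetLike (S i) (R i)] {C : ∀ i, S i}

/-- (Ported verbatim from the HodgeCMPerL package; no docstring in the source.) -/
theorem continuous_evalT (T : Finset ι) : Continuous (evalT C T) :=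
  continuous_pi fun i => RestrictedProduct.continuous_eval i.1

section Open

variable [hC : Fact (∀ i, IsOpen (C i : Set (R i)))]

/-- (Ported verbatim from the HodgeCMPerL package; no docstring in the source.) -/
theorem isOpen_boxSet : IsOpen (boxSet C) := RestrictedProduct.isOpen_forall_mem hC.out

/-- (Ported verbatim from the HodgeCMPerL package; no docstring in the source.) -/
theorem isOpen_cylSet (T : Finset ι) : IsOpen (cylSet C T) := RestrictedProduct.isOpen_forall_imp_mem hC.out

end Open

section Cpt

variable [∀ i, CompactSpace (C i)]

/-- (Ported verbatim from the HodgeCMPerL package; no docstring in the source.) -/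
theorem isCompact_C (i : ι) : IsCompact (C i : Set (R i)) := isCompact_iff_compactSpace.mpr inferInstance

/-- (recorded for Tychonoff on `∏_i C_i`) -/
instance compactSpace_coeC (i : ι) : CompactSpace (C i : Set (R i)) := isCompact_iff_compactSpace.mp (isCompact_C i)

/-- (Ported verbatim from the HodgeCMPerL package; no docstring in the source.) -/
theorem isCompact_boxSet : IsCompact (boxSet C) := by
  have h := isCompact_range (RestrictedProduct.isEmbedding_structureMap (R := R)
    (A := fun i => (C i : Set (R i))) (𝓕 := cofinite)).continuous
  rwa [RestrictedProduct.range_structureMap] at h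

end Cpt

section Box

variable [∀ i, AddCommGroup (R i)] [∀ i, AddSubgroupClass (S i) (R i)] [hC : Fact (∀ i, IsOpen (C i : Set (R i)))]
  [∀ i, CompactSpace (C i)]

/-- the compact open box `∏_{i ∈ T} C_i` of the finite product -/
def piBox (T : Finset ι) : TopologicalSpace.PositiveCompacts (∀ i : T, R i.1) where
  carrier := Set.pi univ fun i : T => (C i.1 : Set (R i.1))
  isCompact' := isCompact_univ_pi fun i => isCompact_C (C := C) i.1
  interior_nonempty' := ⟨0, by
    rw [(isOpen_set_pi finite_univ fun i _ => hC.out i.1).interior_eq]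
    exact fun i _ => zero_mem (C i.1)⟩

/-- (Ported verbatim from the HodgeCMPerL package; no docstring in the source.) -/
theorem coe_piBox (T : Finset ι) :
    ((piBox (C := C) T : TopologicalSpace.PositiveCompacts (∀ i : T, R i.1)) : Set (∀ i : T, R i.1))
      = Set.pi univ fun i : T => (C i.1 : Set (R i.1)) := rfl

/-- (Ported verbatim from the HodgeCMPerL package; no docstring in the source.) -/
theorem isOpen_piBox (T : Finset ι) : IsOpen ((piBox (C := C) T) : Set (∀ i : T, R i.1)) :=
  isOpen_set_pi finite_univ fun i _ => hC.out i.1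

/-- (Ported verbatim from the HodgeCMPerL package; no docstring in the source.) -/
theorem boxSet_eq_cylSet_inter (T : Finset ι) :
    boxSet C = cylSet C T ∩ evalT C T ⁻¹' ((piBox (C := C) T) : Set (∀ i : T, R i.1)) := by
  ext x
  rw [mem_inter_iff, mem_preimage, coe_piBox, mem_univ_pi, mem_boxSet_iff, mem_cylSet_iff]
  refine ⟨fun h => ⟨fun j _ => h j, fun i => h i.1⟩, fun h j => ?_⟩
  by_cases hj : j ∈ T
  · exact h.2 ⟨j, hj⟩
  · exact h.1 j hj

end Box

end Top

/-! ### §2.3 The slice measures `μ|_{cyl_T}` pushed to `∏_{i ∈ T} R_i` are the product Haar measures -/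
section Meas

variable {ι : Type u} {R : ι → Type v} [instACG : ∀ i, AddCommGroup (R i)] [∀ i, TopologicalSpace (R i)]
  [instTAG : ∀ i, IsTopologicalAddGroup (R i)] [instT2 : ∀ i, T2Space (R i)]
  [instSC : ∀ i, SecondCountableTopology (R i)] [instLC : ∀ i, LocallyCompactSpace (R i)]
  [∀ i, MeasurableSpace (R i)] [instB : ∀ i, BorelSpace (R i)]
  {S : ι → Type w} [∀ i, SetLike (S i) (R i)] [instASG : ∀ i, AddSubgroupClass (S i) (R i)]
  {C : ∀ i, S i} [hC : Fact (∀ i, IsOpen (C i : Set (R i)))] [instCpt : ∀ i, CompactSpace (C i)]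
  (m : ∀ i, Measure (R i)) [instHm : ∀ i, (m i).IsAddHaarMeasure]

omit instT2 in
/-- the product of the local Haar measures normalised on the `C_i` is the Haar measure of `∏_{i∈T} R_i`
normalised on `∏_{i ∈ T} C_i` -/
theorem pi_eq_addHaarMeasure (hm : ∀ i, m i (C i) = 1) (T : Finset ι) :
    Measure.pi (fun i : T => m i.1) = addHaarMeasure (piBox (C := C) T) := by
  refine ((addHaarMeasure_eq_iff _ _).2 ?_).symm
  change Measure.pi (fun i : T => m i.1) (Set.pi univ fun i : T => (C i.1 : Set (R i.1))) = 1
  rw [Measure.pi_pi]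
  exact Finset.prod_eq_one fun i _ => hm i.1

variable [instMX : MeasurableSpace (Πʳ i, [R i, C i])] [instBX : BorelSpace (Πʳ i, [R i, C i])]
  (μ : Measure (Πʳ i, [R i, C i]))

/-- the slice measure over `T`: `μ|_{cyl_T}` pushed forward to the `T`-coordinates -/
def sliceT (T : Finset ι) : Measure (∀ i : T, R i.1) := (μ.restrict (cylSet C T)).map (evalT C T)

omit instACG instTAG instT2 instLC instASG instCpt in
/-- (Ported verbatim from the HodgeCMPerL package; no docstring in the source.) -/
theorem sliceT_apply (T : Finset ι) {A : Set (∀ i : T, R i.1)} (hA : MeasurableSet A) :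
    sliceT μ T A = μ (cylSet C T ∩ evalT C T ⁻¹' A) := by
  rw [sliceT, Measure.map_apply (continuous_evalT T).measurable hA,
    Measure.restrict_apply' (isOpen_cylSet T).measurableSet, inter_comm]

variable [instHaar : μ.IsAddHaarMeasure]

/-- the slice measure is translation invariant (translate inside `Πʳ` by `embT a`, which preserves the cylinder) -/
instance isAddLeftInvariant_sliceT (T : Finset ι) : (sliceT μ T).IsAddLeftInvariant := by
  refine ⟨fun a => ?_⟩
  rw [sliceT, Measure.map_map (measurable_const_add a) (continuous_evalT T).measurable]
  have hcomp : ((fun y : ∀ i : T, R i.1 => a + y) ∘ evalT C T) = evalT C T ∘ fun x => embT C T a + x := by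
    funext x
    simp only [Function.comp_apply, evalT_embT_add]
  rw [hcomp, ← Measure.map_map (continuous_evalT T).measurable (measurable_const_add _)]
  congr 1
  have h := Measure.restrict_map (μ := μ) (measurable_const_add (embT C T a)) (isOpen_cylSet T).measurableSet
  rw [preimage_add_embT_cylSet, map_add_left_eq_self] at h
  exact h.symm

/-- the slice measure is finite on compact sets (a compact set of `∏_{i ∈ T} R_i` is covered by finitely many
translates of the open box `∏_{i ∈ T} C_i`, so the slice over it by finitely many translates of `∏_i C_i`) -/
instance isFiniteMeasureOnCompacts_sliceT (T : Finset ι) : IsFiniteMeasureOnCompacts (sliceT μ T) := by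
  refine ⟨fun K hK => ?_⟩
  rw [sliceT_apply μ T hK.measurableSet]
  obtain ⟨F, hF⟩ := hK.elim_finite_subcover
    (fun c : ∀ i : T, R i.1 => (fun y => c + y) '' ((piBox (C := C) T) : Set (∀ i : T, R i.1)))
    (fun c => (isOpenMap_add_left c) _ (isOpen_piBox T))
    (fun c _ => mem_iUnion.2 ⟨c, ⟨0, fun i _ => zero_mem (C i.1), add_zero c⟩⟩)
  have hsub : cylSet C T ∩ evalT C T ⁻¹' K ⊆ ⋃ c ∈ F, (fun x => -embT C T c + x) ⁻¹' boxSet C := by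
    rintro x ⟨hx, hxK⟩
    obtain ⟨c, hcF, y, hy, hcy⟩ : ∃ c ∈ F, ∃ y ∈ ((piBox (C := C) T) : Set (∀ i : T, R i.1)),
        c + y = evalT C T x := by
      simpa only [mem_iUnion, mem_image, exists_prop] using hF hxK
    refine mem_iUnion₂.2 ⟨c, hcF, ?_⟩
    rw [mem_preimage, mem_boxSet_iff]
    intro j
    by_cases hj : j ∈ T
    · have hcyj : c ⟨j, hj⟩ + y ⟨j, hj⟩ = x j := by
        rw [← Pi.add_apply, hcy, evalT_apply]
      rw [RestrictedProduct.add_apply, RestrictedProduct.neg_apply, embT_apply_of_mem T c hj, ← hcyj,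
        neg_add_cancel_left]
      exact hy ⟨j, hj⟩ (mem_univ _)
    · rw [RestrictedProduct.add_apply, RestrictedProduct.neg_apply, embT_apply_of_not_mem T c hj, neg_zero,
        zero_add]
      exact hx j hj
  refine lt_of_le_of_lt (measure_mono hsub) ?_
  refine lt_of_le_of_lt (measure_biUnion_finset_le F _) ?_
  simp only [measure_preimage_add]
  exact ENNReal.sum_lt_top.2 fun _ _ => isCompact_boxSet.measure_lt_top

omit instTAG instLC instHaar in
/-- (Ported verbatim from the HodgeCMPerL package; no docstring in the source.) -/
theorem sliceT_piBox (hμ : μ (boxSet C) = 1) (T : Finset ι) : sliceT μ T (piBox (C := C) T) = 1 := by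
  rw [sliceT_apply μ T (piBox T).isCompact.measurableSet, ← boxSet_eq_cylSet_inter, hμ]

/-- **`μ|_{cyl_T}` pushed to the `T`-coordinates is the Haar measure of `∏_{i∈T} R_i` normalised on `∏ C_i`** -/
theorem sliceT_eq_addHaarMeasure (hμ : μ (boxSet C) = 1) (T : Finset ι) :
    sliceT μ T = addHaarMeasure (piBox (C := C) T) :=
  ((addHaarMeasure_eq_iff _ _).2 (sliceT_piBox μ hμ T)).symm

/-- **the `T`-coordinates are MEASURE PRESERVING** from `(cyl_T, μ)` to `(∏_{i ∈ T} R_i, ⊗_{i ∈ T} m_i)` -/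
theorem measurePreserving_evalT (hμ : μ (boxSet C) = 1) (hm : ∀ i, m i (C i) = 1) (T : Finset ι) :
    MeasurePreserving (evalT C T) (μ.restrict (cylSet C T)) (Measure.pi fun i : T => m i.1) :=
  ⟨(continuous_evalT T).measurable, by
    rw [pi_eq_addHaarMeasure m hm T, ← sliceT_eq_addHaarMeasure μ hμ T]; rfl⟩

end Meas

/-! ### §2.4 Extension by zero `L²(s, μ|_s) ↪ L²(μ)` -/
section ExtendZero

variable {α : Type*} [MeasurableSpace α] {m : Measure α} {s : Set α}

/-- (Ported verbatim from the HodgeCMPerL package; no docstring in the source.) -/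
theorem memLp_indicator_of_restrict (hs : MeasurableSet s) (f : Lp ℂ 2 (m.restrict s)) :
    MemLp (s.indicator ⇑f) 2 m :=
  (memLp_indicator_iff_restrict hs).2 (Lp.memLp f)

/-- extension by zero: `f ∈ L²(μ|_s) ↦ 1_s · f ∈ L²(μ)`, a linear isometry -/
def extendZero (hs : MeasurableSet s) : Lp ℂ 2 (m.restrict s) →ₗᵢ[ℂ] Lp ℂ 2 m where
  toFun f := (memLp_indicator_of_restrict hs f).toLp _
  map_add' f g := by
    rw [← MemLp.toLp_add]
    refine MemLp.toLp_congr _ _ ?_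
    have h := (ae_eq_restrict_iff_indicator_ae_eq hs).1 (Lp.coeFn_add f g)
    refine h.trans (Filter.Eventually.of_forall fun x => ?_)
    rw [Set.indicator_add']
  map_smul' c f := by
    rw [RingHom.id_apply, ← MemLp.toLp_const_smul]
    refine MemLp.toLp_congr _ _ ?_
    have h := (ae_eq_restrict_iff_indicator_ae_eq hs).1 (Lp.coeFn_smul c f)
    refine h.trans (Filter.Eventually.of_forall fun x => ?_)
    by_cases hx : x ∈ s
    · simp only [Set.indicator_of_mem hx, Pi.smul_apply]
    · simp only [Set.indicator_of_notMem hx, Pi.smul_apply, smul_zero]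
  norm_map' f := by
    simp only [LinearMap.coe_mk, AddHom.coe_mk]
    rw [Lp.norm_toLp, eLpNorm_indicator_eq_eLpNorm_restrict hs, Lp.norm_def]

/-- (Ported verbatim from the HodgeCMPerL package; no docstring in the source.) -/
theorem coeFn_extendZero (hs : MeasurableSet s) (f : Lp ℂ 2 (m.restrict s)) :
    ⇑(extendZero hs f) =ᵐ[m] s.indicator ⇑f :=
  MemLp.coeFn_toLp (memLp_indicator_of_restrict hs f)

end ExtendZero

/-! ### §2.5 Product functions `∏_{i ∈ T} f_i(w_i)` on a finite product -/
section PiFun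

variable {T : Type*} [Fintype T] {Y : T → Type*} [∀ i, MeasurableSpace (Y i)] (n : ∀ i, Measure (Y i))
  [∀ i, SigmaFinite (n i)]

/-- the product function `w ↦ ∏_i f_i(w_i)` of `f_i ∈ L²(Y_i, n_i)` -/
def piFun (f : ∀ i, Lp ℂ 2 (n i)) : (∀ i, Y i) → ℂ := fun w => ∏ i, (f i : Y i → ℂ) (w i)

/-- (Ported verbatim from the HodgeCMPerL package; no docstring in the source.) -/
theorem aestronglyMeasurable_piFun (f : ∀ i, Lp ℂ 2 (n i)) :
    AEStronglyMeasurable (piFun n f) (Measure.pi n) :=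
  Finset.aestronglyMeasurable_fun_prod Finset.univ fun i _ =>
    (Lp.aestronglyMeasurable (f i)).comp_quasiMeasurePreserving (Measure.quasiMeasurePreserving_eval n i)

/-- `∏_i f_i(w_i) ∈ L²(∏ Y_i, ⊗ n_i)` (Tonelli on the finite product) -/
theorem memLp_piFun (f : ∀ i, Lp ℂ 2 (n i)) : MemLp (piFun n f) 2 (Measure.pi n) := by
  refine (memLp_two_iff_integrable_sq_norm (aestronglyMeasurable_piFun n f)).2 ?_
  have h : ∀ i, Integrable (fun a => ‖(f i : Y i → ℂ) a‖ ^ 2) (n i) := fun i =>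
    (memLp_two_iff_integrable_sq_norm (Lp.aestronglyMeasurable _)).1 (Lp.memLp (f i))
  refine (Integrable.fintype_prod_dep (𝕜 := ℝ) h).congr (Eventually.of_forall fun w => ?_)
  simp only [piFun, norm_prod, Finset.prod_pow]

/-- the product function as an element of `L²` -/
def piLp (f : ∀ i, Lp ℂ 2 (n i)) : Lp ℂ 2 (Measure.pi n) := (memLp_piFun n f).toLp _

/-- (Ported verbatim from the HodgeCMPerL package; no docstring in the source.) -/
theorem coeFn_piLp (f : ∀ i, Lp ℂ 2 (n i)) : ⇑(piLp n f) =ᵐ[Measure.pi n] piFun n f :=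
  MemLp.coeFn_toLp _

/-- (Ported verbatim from the HodgeCMPerL package; no docstring in the source.) -/
theorem inner_prod_prod {β : Type*} (s : Finset β) (a b : β → ℂ) :
    ⟪∏ i ∈ s, a i, ∏ i ∈ s, b i⟫_ℂ = ∏ i ∈ s, ⟪a i, b i⟫_ℂ := by
  simp only [RCLike.inner_apply', map_prod, Finset.prod_mul_distrib]

/-- `⟪∏ f_i, ∏ g_i⟫_{L²(⊗ n_i)} = ∏_i ⟪f_i, g_i⟫` (Fubini on the finite product) -/
theorem inner_piLp (f g : ∀ i, Lp ℂ 2 (n i)) : ⟪piLp n f, piLp n g⟫_ℂ = ∏ i, ⟪f i, g i⟫_ℂ := by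
  rw [MeasureTheory.L2.inner_def]
  have h1 : (fun w => ⟪(piLp n f) w, (piLp n g) w⟫_ℂ)
      =ᵐ[Measure.pi n] fun w => ∏ i, ⟪(f i : Y i → ℂ) (w i), (g i : Y i → ℂ) (w i)⟫_ℂ := by
    filter_upwards [coeFn_piLp n f, coeFn_piLp n g] with w hf hg
    rw [hf, hg, piFun, piFun, inner_prod_prod]
  rw [integral_congr_ae h1,
    integral_fintype_prod_eq_prod (𝕜 := ℂ) (fun (i : T) (a : Y i) => ⟪(f i : Y i → ℂ) a, (g i : Y i → ℂ) a⟫_ℂ)]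
  exact Finset.prod_congr rfl fun i _ => (MeasureTheory.L2.inner_def (f i) (g i)).symm

end PiFun

/-! ### §2.6 The reference vectors `1_{C_i} ∈ L²(R_i, m_i)` -/
section CInd

variable {ι : Type u} {R : ι → Type v} [∀ i, TopologicalSpace (R i)] [∀ i, MeasurableSpace (R i)]
  [∀ i, BorelSpace (R i)] {S : ι → Type w} [∀ i, SetLike (S i) (R i)] {C : ∀ i, S i}
  [hC : Fact (∀ i, IsOpen (C i : Set (R i)))] [∀ i, CompactSpace (C i)]
  (m : ∀ i, Measure (R i)) [∀ i, IsFiniteMeasureOnCompacts (m i)]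

variable (C) in
/-- the reference vectors `1_{C_i} ∈ L²(R_i, m_i)` -/
def cInd (i : ι) : Lp ℂ 2 (m i) :=
  indicatorConstLp 2 (hC.out i).measurableSet (isCompact_C (C := C) i).measure_lt_top.ne (1 : ℂ)

/-- (Ported verbatim from the HodgeCMPerL package; no docstring in the source.) -/
theorem coeFn_cInd (i : ι) : ⇑(cInd C m i) =ᵐ[m i] (C i : Set (R i)).indicator fun _ => (1 : ℂ) :=
  indicatorConstLp_coeFn

/-- (Ported verbatim from the HodgeCMPerL package; no docstring in the source.) -/
theorem norm_cInd (hm : ∀ i, m i (C i) = 1) (i : ι) : ‖cInd C m i‖ = 1 := by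
  rw [cInd, norm_indicatorConstLp (by norm_num) (by norm_num), norm_one, one_mul, measureReal_def, hm i,
    ENNReal.toReal_one, Real.one_rpow]

end CInd

/-! ### §2.7 The product functions `1_{cyl_T}(x) ∏_{i ∈ T} f_i(x_i) ∈ L²(Πʳ_i [R_i, C_i], μ)` -/
section ProdLp

variable {ι : Type u} {R : ι → Type v} [instACG : ∀ i, AddCommGroup (R i)] [∀ i, TopologicalSpace (R i)]
  [instTAG : ∀ i, IsTopologicalAddGroup (R i)] [instT2 : ∀ i, T2Space (R i)]
  [instSC : ∀ i, SecondCountableTopology (R i)] [instLC : ∀ i, LocallyCompactSpace (R i)]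
  [∀ i, MeasurableSpace (R i)] [instB : ∀ i, BorelSpace (R i)]
  {S : ι → Type w} [∀ i, SetLike (S i) (R i)] [instASG : ∀ i, AddSubgroupClass (S i) (R i)]
  {C : ∀ i, S i} [hC : Fact (∀ i, IsOpen (C i : Set (R i)))] [instCpt : ∀ i, CompactSpace (C i)]
  [instMX : MeasurableSpace (Πʳ i, [R i, C i])] [instBX : BorelSpace (Πʳ i, [R i, C i])]
  (μ : Measure (Πʳ i, [R i, C i])) [instHaar : μ.IsAddHaarMeasure] (hμ : μ (boxSet C) = 1)
  (m : ∀ i, Measure (R i)) [instHm : ∀ i, (m i).IsAddHaarMeasure] (hm : ∀ i, m i (C i) = 1)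

/-- **the product function** `x ↦ 1_{cyl_T}(x) · ∏_{i ∈ T} f_i(x_i)` of `f_i ∈ L²(R_i, m_i)`, an element of
`L²(Πʳ_i [R_i, C_i], μ)`: the `T`-coordinates are measure preserving on the cylinder (§2.3), so this is the
pull-back of `∏ f_i ∈ L²(∏_{i∈T} R_i)` to `L²(cyl_T, μ)` extended by zero. -/
def prodLp (T : Finset ι) (f : ∀ i, Lp ℂ 2 (m i)) : Lp ℂ 2 μ :=
  extendZero (isOpen_cylSet T).measurableSet
    (Lp.compMeasurePreservingₗᵢ ℂ (evalT C T) (measurePreserving_evalT m μ hμ hm T)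
      (piLp (fun i : T => m i.1) fun i : T => f i.1))

include hμ hm in
/-- (Ported verbatim from the HodgeCMPerL package; no docstring in the source.) -/
theorem quasiMeasurePreserving_apply (T : Finset ι) (i : T) :
    Measure.QuasiMeasurePreserving (fun x : Πʳ i, [R i, C i] => x i.1) (μ.restrict (cylSet C T)) (m i.1) :=
  (Measure.quasiMeasurePreserving_eval (fun i : T => m i.1) i).comp
    (measurePreserving_evalT m μ hμ hm T).quasiMeasurePreserving

/-- `prodLp T f = 1_{cyl_T} · ∏_{i ∈ T} f_i(x_i)` almost everywhere -/
theorem coeFn_prodLp (T : Finset ι) (f : ∀ i, Lp ℂ 2 (m i)) :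
    ⇑(prodLp μ hμ m hm T f) =ᵐ[μ] (cylSet C T).indicator fun x => ∏ i : T, (f i.1 : R i.1 → ℂ) (x i.1) := by
  refine (coeFn_extendZero (isOpen_cylSet T).measurableSet _).trans ?_
  refine (ae_eq_restrict_iff_indicator_ae_eq (isOpen_cylSet T).measurableSet).1 ?_
  refine (Lp.coeFn_compMeasurePreserving _ _).trans ?_
  exact (measurePreserving_evalT m μ hμ hm T).quasiMeasurePreserving.ae_eq_comp
    (coeFn_piLp (fun i : T => m i.1) fun i : T => f i.1)

/-- **`⟪1_{cyl_T} ∏ f_i, 1_{cyl_T} ∏ g_i⟫_{L²(μ)} = ∏_{i ∈ T} ⟪f_i, g_i⟫_{L²(m_i)}`** -/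
theorem inner_prodLp (T : Finset ι) (f g : ∀ i, Lp ℂ 2 (m i)) :
    ⟪prodLp μ hμ m hm T f, prodLp μ hμ m hm T g⟫_ℂ = ∏ i ∈ T, ⟪f i, g i⟫_ℂ := by
  rw [prodLp, prodLp, LinearIsometry.inner_map_map, LinearIsometry.inner_map_map, inner_piLp]
  exact Finset.prod_coe_sort T fun i => ⟪f i, g i⟫_ℂ

/-- `‖1_{cyl_T} ∏ f_i‖_{L²(μ)} = ∏_{i ∈ T} ‖f_i‖_{L²(m_i)}` -/
theorem norm_prodLp (T : Finset ι) (f : ∀ i, Lp ℂ 2 (m i)) : ‖prodLp μ hμ m hm T f‖ = ∏ i ∈ T, ‖f i‖ := by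
  have h1 : ⟪prodLp μ hμ m hm T f, prodLp μ hμ m hm T f⟫_ℂ = ((‖prodLp μ hμ m hm T f‖ ^ 2 : ℝ) : ℂ) := by
    rw [inner_self_eq_norm_sq_to_K]; norm_cast
  have h2 : ∀ i, ⟪f i, f i⟫_ℂ = ((‖f i‖ ^ 2 : ℝ) : ℂ) := fun i => by
    rw [inner_self_eq_norm_sq_to_K]; norm_cast
  have h : ((‖prodLp μ hμ m hm T f‖ ^ 2 : ℝ) : ℂ) = (((∏ i ∈ T, ‖f i‖) ^ 2 : ℝ) : ℂ) := by
    rw [← h1, inner_prodLp, ← Finset.prod_pow, Complex.ofReal_prod]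
    exact Finset.prod_congr rfl fun i _ => h2 i
  have h' : ‖prodLp μ hμ m hm T f‖ ^ 2 = (∏ i ∈ T, ‖f i‖) ^ 2 := by exact_mod_cast h
  exact (pow_left_inj₀ (norm_nonneg _) (Finset.prod_nonneg fun i _ => norm_nonneg _) two_ne_zero).mp h'

/-- **independence of `T`**: enlarging `T` by coordinates carrying the reference vector `1_{C_i}` does not change
the product function (`1_{C_i}(x_i)` is absorbed into the cylinder's indicator). -/
theorem prodLp_eq_of_subset {T T' : Finset ι} (hTT' : T ⊆ T') (f : ∀ i, Lp ℂ 2 (m i))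
    (hf : ∀ i ∈ T', i ∉ T → f i = cInd C m i) : prodLp μ hμ m hm T' f = prodLp μ hμ m hm T f := by
  classical
  have hae : ∀ i : T', ∀ᵐ x ∂μ, x ∈ cylSet C T' → i.1 ∉ T →
      (f i.1 : R i.1 → ℂ) (x i.1) = (C i.1 : Set (R i.1)).indicator (fun _ => (1 : ℂ)) (x i.1) := by
    intro i
    rw [← ae_restrict_iff' (isOpen_cylSet T').measurableSet]
    by_cases hi : i.1 ∈ T
    · exact Eventually.of_forall fun x h => absurd hi h
    · have h := (quasiMeasurePreserving_apply μ hμ m hm T' i).ae_eq_comp (coeFn_cInd (C := C) m i.1)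
      rw [← hf i.1 i.2 hi] at h
      filter_upwards [h] with x hx _
      exact hx
  refine Lp.ext_iff.2 ?_
  filter_upwards [coeFn_prodLp μ hμ m hm T' f, coeFn_prodLp μ hμ m hm T f, ae_all_iff.2 hae] with x h' h hx
  rw [h', h]
  by_cases hx' : x ∈ cylSet C T'
  · rw [indicator_of_mem hx']
    by_cases hxT : x ∈ cylSet C T
    · rw [indicator_of_mem hxT, Finset.prod_coe_sort T' fun j => (f j : R j → ℂ) (x j),
        Finset.prod_coe_sort T fun j => (f j : R j → ℂ) (x j), ← Finset.prod_sdiff hTT', Finset.prod_eq_one,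
        one_mul]
      intro j hj
      rw [Finset.mem_sdiff] at hj
      rw [hx ⟨j, hj.1⟩ hx' hj.2]
      exact indicator_of_mem (hxT j hj.2) _
    · rw [indicator_of_notMem hxT]
      obtain ⟨j, hjT, hxj⟩ : ∃ j, j ∉ T ∧ x j ∉ (C j : Set (R j)) := by
        simpa only [mem_cylSet_iff, not_forall, exists_prop] using hxT
      have hjT' : j ∈ T' := by
        by_contra hj
        exact hxj (hx' j hj)
      refine Finset.prod_eq_zero (Finset.mem_univ (⟨j, hjT'⟩ : T')) ?_
      rw [hx ⟨j, hjT'⟩ hx' hjT]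
      exact indicator_of_notMem hxj _
  · rw [indicator_of_notMem hx', indicator_of_notMem fun h => hx' (cylSet_mono hTT' h)]

/-- the empty product function is the indicator of the box `∏_i C_i` -/
theorem prodLp_empty (f : ∀ i, Lp ℂ 2 (m i)) :
    prodLp μ hμ m hm ∅ f = indicatorConstLp 2 (isOpen_boxSet (C := C)).measurableSet
      (isCompact_boxSet (C := C)).measure_lt_top.ne (1 : ℂ) := by
  refine Lp.ext_iff.2 ?_
  filter_upwards [coeFn_prodLp μ hμ m hm ∅ f,
    (indicatorConstLp_coeFn : ⇑(indicatorConstLp 2 (isOpen_boxSet (C := C)).measurableSet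
      (isCompact_boxSet (C := C)).measure_lt_top.ne (1 : ℂ)) =ᵐ[μ] _)] with x hx hx'
  rw [hx, hx', cylSet_empty]
  by_cases hb : x ∈ boxSet C
  · rw [indicator_of_mem hb, indicator_of_mem hb, Finset.univ_eq_empty, Finset.prod_empty]
  · rw [indicator_of_notMem hb, indicator_of_notMem hb]

end ProdLp

end ProdL2

/-! ## §3  The dictionary `⊗_i f_i ↦ (x ↦ ∏_i f_i(x_i))`:
`⊗′_i (L²(R_i, m_i), 1_{C_i}) →ₗᵢ L²(Πʳ_i [R_i, C_i], μ)` -/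
section TensorToL2

open ProdL2

universe w

variable {ι : Type u} {R : ι → Type v} [instACG : ∀ i, AddCommGroup (R i)] [∀ i, TopologicalSpace (R i)]
  [instTAG : ∀ i, IsTopologicalAddGroup (R i)] [instT2 : ∀ i, T2Space (R i)]
  [instSC : ∀ i, SecondCountableTopology (R i)] [instLC : ∀ i, LocallyCompactSpace (R i)]
  [∀ i, MeasurableSpace (R i)] [instB : ∀ i, BorelSpace (R i)]
  {S : ι → Type w} [∀ i, SetLike (S i) (R i)] [instASG : ∀ i, AddSubgroupClass (S i) (R i)]
  {C : ∀ i, S i} [hC : Fact (∀ i, IsOpen (C i : Set (R i)))] [instCpt : ∀ i, CompactSpace (C i)]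
  [instMX : MeasurableSpace (Πʳ i, [R i, C i])] [instBX : BorelSpace (Πʳ i, [R i, C i])]
  (μ : Measure (Πʳ i, [R i, C i])) [instHaar : μ.IsAddHaarMeasure] (hμ : μ (boxSet C) = 1)
  (m : ∀ i, Measure (R i)) [instHm : ∀ i, (m i).IsAddHaarMeasure] (hm : ∀ i, m i (C i) = 1)

variable (C) in
omit instTAG instT2 instSC instLC instASG in
/-- the unit family `(L²(R_i, m_i), 1_{C_i})_i` -/
def l2Family : UnitFamily (fun i => Lp ℂ 2 (m i)) where
  e := cInd C m
  norm_e := norm_cInd m hm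

omit instTAG instT2 instSC instLC instASG instMX instBX in
/-- (Ported verbatim from the HodgeCMPerL package; no docstring in the source.) -/
@[simp] theorem l2Family_e (i : ι) : (l2Family C m hm).e i = cInd C m i := rfl

/-- the finite set of coordinates where a restricted vector differs from the reference vector -/
def suppOf (x : RVec (l2Family C m hm)) : Finset ι := x.finite_ne.toFinset

omit instTAG instT2 instSC instLC instASG instMX instBX in
/-- (Ported verbatim from the HodgeCMPerL package; no docstring in the source.) -/
theorem eq_cInd_of_not_mem_suppOf (x : RVec (l2Family C m hm)) {i : ι} (hi : i ∉ suppOf m hm x) :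
    x i = cInd C m i := by
  by_contra h
  exact hi (x.finite_ne.mem_toFinset.2 h)

omit instTAG instT2 instSC instLC instASG instMX instBX in
/-- (Ported verbatim from the HodgeCMPerL package; no docstring in the source.) -/
theorem suppOf_subset (x : RVec (l2Family C m hm)) {T : Finset ι} (hT : ∀ i ∉ T, x i = cInd C m i) :
    suppOf m hm x ⊆ T := by
  intro i hi
  by_contra hiT
  exact (x.finite_ne.mem_toFinset.1 hi) (hT i hiT)

/-- **the pure-tensor dictionary** `⊗_i f_i ↦ (x ↦ ∏_i f_i(x_i))` (the product over the finitely many `i` with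
`f_i ≠ 1_{C_i}`, times the indicator of the cylinder there) -/
def tpFun (x : RVec (l2Family C m hm)) : Lp ℂ 2 μ := prodLp μ hμ m hm (suppOf m hm x) x

/-- the dictionary is computed by ANY finite set of coordinates outside which `f_i = 1_{C_i}` -/
theorem tpFun_eq_prodLp (x : RVec (l2Family C m hm)) (T : Finset ι) (hT : ∀ i ∉ T, x i = cInd C m i) :
    tpFun μ hμ m hm x = prodLp μ hμ m hm T x :=
  (prodLp_eq_of_subset μ hμ m hm (suppOf_subset m hm x hT) x
    fun _ _ hi => eq_cInd_of_not_mem_suppOf m hm x hi).symm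

/-- **the dictionary realises the product kernel**: `⟪∏ f_i, ∏ g_i⟫_{L²(μ)} = ∏ᶠ_i ⟪f_i, g_i⟫_{L²(m_i)}` -/
theorem inner_tpFun (x y : RVec (l2Family C m hm)) : ⟪tpFun μ hμ m hm x, tpFun μ hμ m hm y⟫_ℂ = kfun x y := by
  have hx : {i | x i ≠ (l2Family C m hm).e i} ⊆ ↑(x.finite_ne.union y.finite_ne).toFinset := fun i hi => by
    rw [Set.Finite.coe_toFinset]; exact Or.inl hi
  have hy : {i | y i ≠ (l2Family C m hm).e i} ⊆ ↑(x.finite_ne.union y.finite_ne).toFinset := fun i hi => by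
    rw [Set.Finite.coe_toFinset]; exact Or.inr hi
  have hx' : ∀ i ∉ (x.finite_ne.union y.finite_ne).toFinset, x i = cInd C m i := fun i hi => by
    by_contra h; exact hi (hx h)
  have hy' : ∀ i ∉ (x.finite_ne.union y.finite_ne).toFinset, y i = cInd C m i := fun i hi => by
    by_contra h; exact hi (hy h)
  rw [tpFun_eq_prodLp μ hμ m hm x _ hx', tpFun_eq_prodLp μ hμ m hm y _ hy', inner_prodLp, kfun_eq_prod hx hy]

/-- **`L²` of the restricted product contains the restricted tensor product of the local `L²` spaces**:
THE linear isometry `⊗′_i (L²(R_i, m_i), 1_{C_i}) →ₗᵢ[ℂ] L²(Πʳ_i [R_i, C_i], μ)` extending the pure-tensor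
dictionary `⊗_i f_i ↦ ∏_i f_i(x_i)` (universal property §1 + product kernel §2). -/
def tensorToL2 : Space (l2Family C m hm) →ₗᵢ[ℂ] Lp ℂ 2 μ := lift (tpFun μ hμ m hm) (inner_tpFun μ hμ m hm)

/-- (Ported verbatim from the HodgeCMPerL package; no docstring in the source.) -/
theorem tensorToL2_tp (x : RVec (l2Family C m hm)) :
    tensorToL2 μ hμ m hm (tp (l2Family C m hm) x) = tpFun μ hμ m hm x :=
  lift_tp _ _ x

/-- `tensorToL2 (⊗ f) = 1_{cyl_T} ∏_{i ∈ T} f_i(x_i)` for every finite `T` outside which `f_i = 1_{C_i}` -/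
theorem tensorToL2_tp_eq_prodLp (x : RVec (l2Family C m hm)) (T : Finset ι) (hT : ∀ i ∉ T, x i = cInd C m i) :
    tensorToL2 μ hμ m hm (tp (l2Family C m hm) x) = prodLp μ hμ m hm T x := by
  rw [tensorToL2_tp, tpFun_eq_prodLp μ hμ m hm x T hT]

/-- a.e. formula: `tensorToL2 (⊗ f) (x) = 1_{cyl_T}(x) ∏_{i ∈ T} f_i(x_i)` -/
theorem coeFn_tensorToL2_tp (x : RVec (l2Family C m hm)) (T : Finset ι) (hT : ∀ i ∉ T, x i = cInd C m i) :
    ⇑(tensorToL2 μ hμ m hm (tp (l2Family C m hm) x))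
      =ᵐ[μ] (cylSet C T).indicator fun w => ∏ i : T, (x i.1 : R i.1 → ℂ) (w i.1) := by
  rw [tensorToL2_tp_eq_prodLp μ hμ m hm x T hT]
  exact coeFn_prodLp μ hμ m hm T x

/-- **the vacuum goes to the indicator of the box**: `tensorToL2 (⊗_i 1_{C_i}) = 1_{∏_i C_i}` -/
theorem tensorToL2_vac :
    tensorToL2 μ hμ m hm (tp (l2Family C m hm) (RVec.vac _)) = indicatorConstLp 2
      (isOpen_boxSet (C := C)).measurableSet (isCompact_boxSet (C := C)).measure_lt_top.ne (1 : ℂ) := by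
  rw [tensorToL2_tp_eq_prodLp μ hμ m hm (RVec.vac _) ∅ fun i _ => rfl, prodLp_empty]

/-- the range of `tensorToL2` is the closed span of the product functions -/
theorem range_tensorToL2 :
    (LinearMap.range (tensorToL2 μ hμ m hm).toLinearMap : Set (Lp ℂ 2 μ))
      = closure (Submodule.span ℂ (Set.range (tpFun μ hμ m hm)) : Set (Lp ℂ 2 μ)) :=
  range_lift _ _

end TensorToL2



end HodgeCM.PerL34.RestrictedTensor

end
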